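import Summits.BirchSwinnertonDyer.BirchSwinnertonDyer.Theorems.ThetaPartnerAtTwoSignedControlAtTwoSignedEulerCharCount
import Literature.NumberTheory.EllipticCurves.IwasawaTowerTorsionFiniteProofs
import Literature.NumberTheory.EllipticCurves.SelmerCorankControlRatProofs
import HarnessLib

/-!
# Seed crux `SignedMuSeedAtTwoPlus` (stmt-BirchSwinnertonDyer-21438), line `layer-rank-certificate`: stub S5
# `LayerZeroLowerBound` VERBATIM — `#Sel_{2^∞}(A/ℚ)[2] ≤ #Sel⁺(A/ℚ_∞)[2]^γ`

Cell `bsd-wall`, width seat `bsd-wall-rtt-p4-w3` (g3). THEOREMS ONLY (no `def`, no named fact, no `sorry`); helper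
`--supports` the seed crux (= `stub_residualSeedAtTwo` of line `birth` of Kμ⁺ stmt-BirchSwinnertonDyer-20689); BSD is
not proved by this. Route-independent imports.

The control map `h_0 : Sel_{2^∞}(A/ℚ) = Sel_{2^∞}(A/ℚ_0) → Sel⁺(A/ℚ_∞)` exists with no hypothesis (at the bottom layer the
signed condition is the Kummer condition, tp2-p3's `SignedEC.selmerLayer_zero_le_comap_layerToInfty_signedSelmerInfty`), lands in
the `γ`-fixed classes (`range_layerToInfty_le_layerInvariants_holds`, `conjH1_eq_of_mem_layerInvariants_zero`), and is INJECTIVE at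
good supersingular `2`: `#ker h_0 = #A[2^∞]^{Γ_ℚ}` (Greenberg's Lemma 3.2 / 4.3 count, tree
`natCard_ker_layerToInfty_eq_natCard_fixedPoints`, `A(ℚ_∞)[2^∞]` finite by `finite_fixedPoints_kerSubgroup_geomPrimaryTorsion_rat`)
and `#A[2^∞]^{Γ_ℚ} = 1` (`SignedEC.natCard_fixedPoints_geomPrimaryTorsion_two_eq_one`: `A[2]` irreducible since `#Ã(𝔽₂) = 3`).

* `natCard_ker_layerToInfty_zero_eq_one`, `layerToInfty_zero_injective` — `h_0` is injective (good supersingular `2`, any `κ`).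
* `natCard_selmer_twoTorsion_le` — `#{c ∈ Sel_{2^∞}(A/ℚ) : 2c = 0} ≤ #{s ∈ Sel⁺_∞ : 2s = 0, (conj_γ − 1)s = 0}` whenever the
  right side is finite.
* **`layerZeroLowerBound`** = stub S5 `LayerZeroLowerBound` of `Cruxes/SignedMuSeedAtTwoPlus/Lines/layer_rank_certificate.lean`
  VERBATIM (with the layer-1 set given as a `Finset`).

References: [GreenbergLNM1716] §3 Lemma 3.2 (p. 86), §4 Lemma 4.3 (p. 103); [Kobayashi2003] Def. 1.1, Prop. 8.7; [BDKim2013]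
proof of Cor. 3.15.
-/

set_option autoImplicit false
set_option linter.dupNamespace false

noncomputable section

open scoped Classical NumberField

open WeierstrassCurve Literature.NumberTheory.EllipticCurves Literature.NumberTheory.EllipticCurves.IwasawaAlgebra
  Literature.NumberTheory.EllipticCurves.Kobayashi2003 Literature.NumberTheory.EllipticCurves.Rank1Residual
  Literature.NumberTheory.EllipticCurves.IwasawaDual ZpExtension

namespace Summit.BirchSwinnertonDyer.BirchSwinnertonDyer.Theorems.SignedMuAtTwo.LayerZero

variable (A : WeierstrassCurve ℚ) [A.IsElliptic] [A.IsGloballyMinimal]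

/-- **`#ker h_0 = 1` at good supersingular `2`**: the restriction `h_0 : H¹(ℚ, A[2^∞]) → H¹(ℚ_∞, A[2^∞])` along any
`ℤ₂`-extension `κ` of `ℚ` has `#ker h_0 = #A[2^∞]^{Γ_ℚ}` (`A(ℚ_∞)[2^∞]` is finite), and `A[2^∞]^{Γ_ℚ} = 0` because `A[2]` is
irreducible at good supersingular `2`. [cite: GreenbergLNM1716, §3 Lemma 3.2 (p. 86) and §4 Lemma 4.3 (p. 103)] -/
theorem natCard_ker_layerToInfty_zero_eq_one (hss : GoodSS A 2) (κ : ZpExtension ℚ 2) :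
    Nat.card (A.layerToInfty κ 0).ker = 1 := by
  haveI := A.finite_fixedPoints_kerSubgroup_geomPrimaryTorsion_rat κ (p := 2)
  rw [A.natCard_ker_layerToInfty_eq_natCard_fixedPoints κ 0, A.natCard_fixedBy_layerSubgroup_zero_eq κ]
  exact SignedEC.natCard_fixedPoints_geomPrimaryTorsion_two_eq_one A hss

/-- **`h_0` is injective at good supersingular `2`.** [cite: GreenbergLNM1716, §3 Lemma 3.2 (p. 86)] -/
theorem layerToInfty_zero_injective (hss : GoodSS A 2) (κ : ZpExtension ℚ 2) :
    Function.Injective (A.layerToInfty κ 0) := by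
  rw [injective_iff_map_eq_zero]
  intro y hy
  have hbot : (A.layerToInfty κ 0).ker = ⊥ := AddSubgroup.eq_bot_of_card_eq _ (natCard_ker_layerToInfty_zero_eq_one A hss κ)
  have : y ∈ (A.layerToInfty κ 0).ker := (AddMonoidHom.mem_ker).mpr hy
  rw [hbot] at this
  exact (AddSubgroup.mem_bot).mp this

/-- **`#Sel_{2^∞}(A/ℚ)[2] ≤ #Sel⁺(A/ℚ_∞)[2]^γ`** (the right side finite): `Sel_{2^∞}(A/ℚ) ≅ Sel_{2^∞}(A/ℚ_0)`
(`nonempty_selmerLayer_zero_addEquiv`) `↪ Sel⁺(A/ℚ_∞)` by the injective `h_0`, with image in the `γ`-fixed `2`-torsion classes.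
[cite: GreenbergLNM1716, §3 Lemma 3.2 (p. 86)] [cite: Kobayashi2003, Def. 1.1] -/
theorem natCard_selmer_twoTorsion_le (hss : GoodSS A 2) (κ : ZpExtension ℚ 2) (γ : Field.absoluteGaloisGroup ℚ)
    (hfin : {s : signedSelmerInfty A κ 1 | 2 • s = 0 ∧ (conjSignedSelmerInfty A κ 1 γ - 1) s = 0}.Finite) :
    Nat.card {c : A.selmerGroupPInfty 2 // 2 • c = 0} ≤
      Nat.card {s : signedSelmerInfty A κ 1 // 2 • s = 0 ∧ (conjSignedSelmerInfty A κ 1 γ - 1) s = 0} := by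
  obtain ⟨e⟩ := A.nonempty_selmerLayer_zero_addEquiv κ (p := 2)
  haveI : Finite {s : signedSelmerInfty A κ 1 // 2 • s = 0 ∧ (conjSignedSelmerInfty A κ 1 γ - 1) s = 0} :=
    hfin.to_subtype
  -- the map on `2`-torsion: `c ↦ h_0 (e⁻¹ c)`
  have hmem : ∀ y : A.selmerLayer κ 0,
      A.layerToInfty κ 0 (y : A.subgroupH1 2 (κ.layerSubgroup 0)) ∈ signedSelmerInfty A κ 1 := fun y ↦
    SignedEC.selmerLayer_zero_le_comap_layerToInfty_signedSelmerInfty A κ 1 y.2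
  have hfix : ∀ y : A.selmerLayer κ 0,
      (conjSignedSelmerInfty A κ 1 γ - 1) ⟨A.layerToInfty κ 0 (y : A.subgroupH1 2 (κ.layerSubgroup 0)), hmem y⟩ = 0 := by
    intro y
    have hinv : A.layerToInfty κ 0 (y : A.subgroupH1 2 (κ.layerSubgroup 0)) ∈ A.layerInvariants κ 0 :=
      A.range_layerToInfty_le_layerInvariants_holds κ 0 ⟨_, rfl⟩
    have h := (SignedEC.mem_endInvariants_conjSignedSelmerInfty_iff A κ 1 γ ⟨_, hmem y⟩).mpr
      (A.conjH1_eq_of_mem_layerInvariants_zero κ γ hinv)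
    exact (mem_endInvariants_iff _ _).mp h
  let f : {c : A.selmerGroupPInfty 2 // 2 • c = 0} →
      {s : signedSelmerInfty A κ 1 // 2 • s = 0 ∧ (conjSignedSelmerInfty A κ 1 γ - 1) s = 0} := fun c ↦
    ⟨⟨A.layerToInfty κ 0 (e.symm c.1 : A.subgroupH1 2 (κ.layerSubgroup 0)), hmem _⟩,
      ⟨by
        have h2 : (2 : ℕ) • (e.symm c.1) = 0 := by
          rw [two_nsmul, ← e.symm.map_add, ← two_nsmul, c.2, e.symm.map_zero]
        apply Subtype.ext
        change 2 • A.layerToInfty κ 0 ((e.symm c.1 : A.selmerLayer κ 0) : A.subgroupH1 2 (κ.layerSubgroup 0)) = 0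
        rw [← map_nsmul, ← AddSubgroupClass.coe_nsmul, h2, ZeroMemClass.coe_zero, map_zero],
        hfix _⟩⟩
  have hf : Function.Injective f := by
    rintro ⟨c, hc⟩ ⟨c', hc'⟩ h
    have h1 : A.layerToInfty κ 0 (e.symm c : A.subgroupH1 2 (κ.layerSubgroup 0)) =
        A.layerToInfty κ 0 (e.symm c' : A.subgroupH1 2 (κ.layerSubgroup 0)) :=
      congrArg (fun s : {s : signedSelmerInfty A κ 1 // 2 • s = 0 ∧ (conjSignedSelmerInfty A κ 1 γ - 1) s = 0} ↦
        ((s.1 : signedSelmerInfty A κ 1) : A.subgroupH1 2 κ.kerSubgroup)) h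
    have h2 := layerToInfty_zero_injective A hss κ h1
    have h3 : e.symm c = e.symm c' := Subtype.ext h2
    exact Subtype.ext (e.symm.injective h3)
  exact Nat.card_le_card_of_injective f hf

/-- **Stub S5 `stub_layerZeroLowerBound` of line `layer-rank-certificate` (seed crux `SignedMuSeedAtTwoPlus`,
stmt-BirchSwinnertonDyer-21438) — its statement `LayerZeroLowerBound` VERBATIM**: for `A/ℚ` globally minimal, good
supersingular at `2` with `a₂ = 0`, the cyclotomic `κ` with topological generator `γ`, and the layer-1 Finset `F1` of `2`-torsion
plus classes over `ℚ_∞` killed by `conj_γ − 1`: `#Sel_{2^∞}(A/ℚ)[2] ≤ #F1`. (Only `GoodSS A 2` is used.)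
[cite: GreenbergLNM1716, §3 Lemma 3.2 (p. 86)] [cite: Kobayashi2003, Def. 1.1, Prop. 8.7] -/
theorem layerZeroLowerBound :
    ∀ (A : WeierstrassCurve ℚ) [A.IsElliptic] [A.IsGloballyMinimal], GoodSS A 2 → A.frobeniusTrace 2 = 0 →
      ∀ (κ : ZpExtension ℚ 2) (γ : Field.absoluteGaloisGroup ℚ), κ.IsCyclotomic → κ.IsTopGenerator γ →
      ∀ (F1 : Finset (signedSelmerInfty A κ 1)),
        (∀ s, s ∈ F1 ↔ (2 • s = 0 ∧ (conjSignedSelmerInfty A κ 1 γ - 1) s = 0)) →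
        Nat.card {c : A.selmerGroupPInfty 2 // 2 • c = 0} ≤ F1.card := by
  intro A _ _ hss _ κ γ _ _ F1 hF1
  have hset : {s : signedSelmerInfty A κ 1 | 2 • s = 0 ∧ (conjSignedSelmerInfty A κ 1 γ - 1) s = 0} = (F1 : Set _) := by
    ext s
    rw [Set.mem_setOf_eq, Finset.mem_coe, hF1]
  have hfin : {s : signedSelmerInfty A κ 1 | 2 • s = 0 ∧ (conjSignedSelmerInfty A κ 1 γ - 1) s = 0}.Finite := by
    rw [hset]; exact F1.finite_toSet
  refine (natCard_selmer_twoTorsion_le A hss κ γ hfin).trans (le_of_eq ?_)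
  rw [← Nat.card_eq_finsetCard F1]
  exact Nat.card_congr (Equiv.subtypeEquivRight fun s ↦ (hF1 s).symm)

end Summit.BirchSwinnertonDyer.BirchSwinnertonDyer.Theorems.SignedMuAtTwo.LayerZero

end
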